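import Mathlib
import HarnessLib
import Literature.MathematicalPhysics.QuantumLattice.GrassmannGaussConvKernelBound
import Summits.HubbardSuperconductivity.HubbardSuperconductivity.Theorems.KLProgrammeKLRegimeWickCrossIterate
import Summits.HubbardSuperconductivity.HubbardSuperconductivity.Theorems.KLProgrammeKLRegimeWickBubbleColourings
import Literature.MathematicalPhysics.QuantumLattice.GrassmannSpectatorReadout

/-!
# Route `KLProgramme` — crux C4a, S1 (b)(i): DEGREE TRUNCATION of the Gaussian convolution on low kernels —
# `kernel((e^{Δ} − 1)T) m = kernel(ΔT) m + ½·kernel(Δ²T) m` as soon as `T` has no kernels of degree `≥ m + 6`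

Cell `gate-hubbard-kl`, lane hubbard-kl-c4a-1 (g5); helper for stub (C) `stub_twoLeg_curvature` of the engine-flow child `KLRegimeEngineV17F2`
(stmt-HubbardSuperconductivity-20437); memo HOME/hubbard-kl-c4a-1/C4A-PLAN.md §22.10 (S1 (b)).  With `…C4aSecondCumulantCross` (the second cumulant is
`dblFold((e^{Δ_×} − 1)(W̃⁰W̃¹))`) and p1's 4-leg Feynman rules for the one-line and two-line terms (`kernel_dblFold_oneLine_self`, `kernel_dblFold_bubble_self`),
the only missing algebra for «kernel₄ of the second cumulant = 1PR trees + ½·bubbles» is that the `≥ 3`-line terms of `e^{Δ_×} − 1` do not reach degree `4`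
when the two copies have total degree `≤ 8`.  This file proves the generic statement on KERNELS (no degree filtration of the algebra is needed: `Δ` raises the
kernel index by `2`, `kernel_grassmannLaplacian`):

* `kernel_ratSmul`; `kernel_grassmannLaplacian_eq_zero_of`, **`kernel_grassmannLaplacian_pow_eq_zero_of`** (`kernel T (m+2k) ≡ 0 ⟹ kernel (ΔᵏT) m ≡ 0`);
* **`kernel_gaussConv_sub_self_eq`**: `(∀ j ≥ m + 6, kernel T j ≡ 0) ⟹ kernel (e^{Δ_C}T − T) m X = kernel (Δ_C T) m X + ½·kernel (Δ_C(Δ_C T)) m X`;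
* **`kernel_dblFold_gaussConv_sub_self_eq`**: the same read through `dblFold` (`kernel_dblFold`): for `T` in the doubled algebra with no kernels of degree `≥ m + 6`,
  `kernel (dblFold((e^{Δ} − 1)T)) m Z = kernel (dblFold(ΔT)) m Z + ½·kernel (dblFold(Δ(ΔT))) m Z` — with `Δ = Δ_{crossCov C}`, `m = 4`, `T = W̃⁰W̃¹` this is S1 (b)(i).

Generic (commutative `ℚ`-algebra, finite labels); exact algebra; nothing about the model.  References: Salmhofer 1999 §2.3–2.4, §4.2 (4.84) [cite: Salmhofer1999].
-/

noncomputable section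

namespace Summit.HubbardSuperconductivity.HubbardSuperconductivity.Theorems.C4a

set_option linter.dupNamespace false -- summit = problem name (single-conjunct summit), D-0017

open Literature.MathematicalPhysics.QuantumLattice GrassmannAlgebra Finset Matrix
open Summit.HubbardSuperconductivity.HubbardSuperconductivity.Theorems.KLRegimeWick

variable (R : Type*) [CommRing R] [Algebra ℚ R] {Γ : Type*} [Fintype Γ] [DecidableEq Γ]

omit [Fintype Γ] [DecidableEq Γ] in
/-- Kernels commute with rational scalars. -/
theorem kernel_ratSmul (q : ℚ) (F : GrassmannAlgebra R Γ) (m : ℕ) (X : Fin m → Γ) :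
    kernel R (q • F) m X = algebraMap ℚ R q * kernel R F m X := by
  rw [← algebraMap_smul R q F, kernel_smul]

omit [DecidableEq Γ] in
/-- `Δ_C` raises the kernel index by two: if `T` has no `(m+2)`-kernels then `Δ_C T` has no `m`-kernels. -/
theorem kernel_grassmannLaplacian_eq_zero_of (C : Matrix Γ Γ R) {T : GrassmannAlgebra R Γ} {m : ℕ}
    (h : ∀ Y : Fin (m + 2) → Γ, kernel R T (m + 2) Y = 0) (X : Fin m → Γ) : kernel R (grassmannLaplacian R C T) m X = 0 := by
  rw [kernel_grassmannLaplacian]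
  simp [h]

omit [DecidableEq Γ] in
/-- Iterated: if `T` has no kernels of degree `≥ m + 2k` then `Δ_Cᵏ T` has no `m`-kernels. -/
theorem kernel_grassmannLaplacian_pow_eq_zero_of (C : Matrix Γ Γ R) (k : ℕ) :
    ∀ {T : GrassmannAlgebra R Γ} {m : ℕ}, (∀ j, m + 2 * k ≤ j → ∀ Y : Fin j → Γ, kernel R T j Y = 0) →
      ∀ X : Fin m → Γ, kernel R ((grassmannLaplacian R C ^ k) T) m X = 0 := by
  induction k with
  | zero => intro T m h X; simpa using h m (by omega) X
  | succ k ih =>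
    intro T m h X
    rw [pow_succ, Module.End.mul_apply]
    refine ih (T := grassmannLaplacian R C T) (m := m) (fun j hj Y => ?_) X
    exact kernel_grassmannLaplacian_eq_zero_of R C (m := j) (fun Y' => h (j + 2) (by omega) Y') Y

omit [DecidableEq Γ] in
/-- **Degree truncation of the Gaussian convolution on the `m`-kernels**: if `T` has no kernels of degree `≥ m + 6`, then
`kernel (e^{Δ_C}T − T) m X = kernel (Δ_C T) m X + ½·kernel (Δ_C(Δ_C T)) m X` — the terms `Δ_Cᵏ/k!`, `k ≥ 3`, of the exponential do not reach degree `m`.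
[cite: Salmhofer1999, §4.2 (4.84)] -/
theorem kernel_gaussConv_sub_self_eq (C : Matrix Γ Γ R) {T : GrassmannAlgebra R Γ} {m : ℕ}
    (hdeg : ∀ j, m + 6 ≤ j → ∀ Y : Fin j → Γ, kernel R T j Y = 0) (X : Fin m → Γ) :
    kernel R (gaussConv R C T - T) m X =
      kernel R (grassmannLaplacian R C T) m X + ((2 : ℚ)⁻¹ • (1 : R)) * kernel R (grassmannLaplacian R C (grassmannLaplacian R C T)) m X := by
  obtain ⟨k, hk⟩ := isNilpotent_grassmannLaplacian R C
  have hk3 : grassmannLaplacian R C ^ (k + 3) = 0 := by rw [pow_add, hk, zero_mul]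
  rw [gaussConv, IsNilpotent.exp_eq_sum hk3, LinearMap.coe_sum, Finset.sum_apply, Finset.sum_range_succ', Finset.sum_range_succ',
    Finset.sum_range_succ']
  -- the tail `k ≥ 3` has no `m`-kernels
  have htail : kernel R (∑ i ∈ Finset.range k, (((i + 1 + 1 + 1).factorial : ℚ)⁻¹ • grassmannLaplacian R C ^ (i + 1 + 1 + 1)) T) m X = 0 := by
    rw [kernel_finset_sum]
    refine Finset.sum_eq_zero fun i _ => ?_
    rw [LinearMap.smul_apply, kernel_ratSmul,
      kernel_grassmannLaplacian_pow_eq_zero_of R C (i + 1 + 1 + 1) (fun j hj Y => hdeg j (by omega) Y) X, mul_zero]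
  rw [kernel_sub_gen, kernel_add, kernel_add, kernel_add, htail, zero_add, LinearMap.smul_apply, LinearMap.smul_apply, LinearMap.smul_apply,
    kernel_ratSmul, kernel_ratSmul, kernel_ratSmul]
  simp only [pow_zero, Module.End.one_apply, Nat.factorial, Nat.cast_one, inv_one, map_one, one_mul, pow_one, Nat.reduceAdd,
    pow_two, Module.End.mul_apply]
  rw [← Algebra.algebraMap_eq_smul_one]
  norm_num
  ring

/-- **The same read through `dblFold`** (S1 (b)(i)): for `T` in the doubled algebra with no kernels of degree `≥ m + 6`,
`kernel (dblFold((e^{Δ} − 1)T)) m Z = kernel (dblFold(ΔT)) m Z + ½·kernel (dblFold(Δ(ΔT))) m Z`; use with `Δ = Δ_{crossCov C}`, `m = 4`, `T = W̃⁰·W̃¹`. -/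
theorem kernel_dblFold_gaussConv_sub_self_eq (D : Matrix (Γ × Fin 2) (Γ × Fin 2) R) {T : GrassmannAlgebra R (Γ × Fin 2)} {m : ℕ}
    (hdeg : ∀ j, m + 6 ≤ j → ∀ Y : Fin j → Γ × Fin 2, kernel R T j Y = 0) (Z : Fin m → Γ) :
    kernel R (dblFold R ((gaussConv R D - 1) T)) m Z =
      kernel R (dblFold R (grassmannLaplacian R D T)) m Z +
        ((2 : ℚ)⁻¹ • (1 : R)) * kernel R (dblFold R (grassmannLaplacian R D (grassmannLaplacian R D T))) m Z := by
  rw [kernel_dblFold, kernel_dblFold, kernel_dblFold, Finset.mul_sum, ← Finset.sum_add_distrib]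
  refine Finset.sum_congr rfl fun s _ => ?_
  rw [LinearMap.sub_apply, Module.End.one_apply]
  exact kernel_gaussConv_sub_self_eq R D hdeg _

end Summit.HubbardSuperconductivity.HubbardSuperconductivity.Theorems.C4a

end
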